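import Summits.QuantumAdvantage.QuantumAdvantage.Theorems.SosSandwichPseudoBoundedAASymmetricCornerSharp
import Summits.QuantumAdvantage.QuantumAdvantage.Theorems.SosSandwichPseudoBoundedAAChebyshevCalibration
import HarnessLib

/-!
# Crux `PseudoBoundedAA` (stmt-QuantumAdvantage-15237) — the symmetric sub-cone of `K` is SETTLED:
# a law `maxInf ≥ C·Var^a/T^b` holds on all weight-symmetric pseudo-bounded polynomials iff `a ≥ 2 ∧ b ≥ 2`

`Theorems/SosSandwichPseudoBoundedAASymmetricCornerSharp.lean` proves PB-AA on the SYMMETRIC CORNER (cube values depend only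
on the Hamming weight) in the card's sharp shape: `∃ i, (1/256)(Var/T)² ≤ Inf_i[p]` for every weight-symmetric `p ∈ K_T`.
This file closes the corner from the other side and packages the two into an `iff`:

* §1 the DEGREE-ONE symmetric member `p_n = |x|/n ∈ K_1` (`p_n = Σ_i (x_i/√n)²`, `1 − p_n = Σ_i ((1 − x_i)/√n)²` on the cube):
  `E p_n = 1/2`, `Var[p_n] = 1/(4n)`, EVERY `Inf_i[p_n] = 1/n² = 16·Var²` — so on the symmetric corner the `Var`-exponent of any
  law is `≥ 2` (`evalBool_linearFamily`, `pseudoBounded_linearFamily`, `boolAvg_linearFamily`, `boolVariance_linearFamily`,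
  `influence_linearFamily`);
* §2 the tree's Chebyshev calibrator (`chebyshev_calibration`: `p = T_{12r}(ȳ)²` on `n = 144 r²` bits is pseudo-bounded of
  order `12r`, `Var ≥ 1/2592`, every `Inf_i ≤ 29/(12r)²`) IS weight-symmetric (`chebyshev_symmetric`) — so the `T`-exponent
  of any law on the symmetric corner is `≥ 2`;
* §3 **`symmetricCorner_law_iff`**: for real `a, b`,
  `(∃ C > 0, ∀ weight-symmetric p ∈ K_T (T ≥ 1, Var > 0), ∃ i, C·Var[p]^a/T^b ≤ Inf_i[p]) ↔ (2 ≤ a ∧ 2 ≤ b)`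
  (`←` from `pseudoBoundedAA_symmetricCorner_sharp` with `C = 1/256`, `Var ≤ 1`, `T ≥ 1`; `→` from §1 and §2 by the
  archimedean bookkeeping of `Theorems/SosSandwichPseudoBoundedAAExponentCornerRpow.lean`).

So on the symmetric sub-cone the admissible exponent region of PB-AA laws is EXACTLY the quadrant `{a ≥ 2, b ≥ 2}`, with the
corner `(2, 2)` attained — the card's prediction `(c, exponent of T) = (2, 2)` is correct and optimal there.  (On all of `K`
the necessity `a ≥ 2 ∧ b ≥ 2` is the tree's `pseudoBounded_exponent_corner_rpow`; sufficiency on `K` is the open crux.)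

Honest label: calibration/corner of an open conjecture; no registered stub, crux or summit is closed.
Sources: Aaronson–Ambainis arXiv:0911.0996 Conj. 6; Kaniewski–Lee–de Wolf arXiv:1411.7280 Def. 7; Beals et al. 2001 §4
(amplitude amplification profile); O'Donnell 2014 §2.3.
-/

-- D-0017: single-conjunct summit ⇒ the duplicate `QuantumAdvantage.QuantumAdvantage` is mandated.
set_option linter.dupNamespace false

noncomputable section

open Finset
open Literature.Computability.QuantumComplexity

namespace Summit.QuantumAdvantage.QuantumAdvantage.Theorems.SosSandwich.SymmetricCorner

/-! ### §1 The degree-one symmetric member of `K_1`: `p_n = |x|/n` -/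

/-- Cube values of `p_n = (1/n) Σ_i X_i`: `p_n(x) = |x|/n`. [folklore] -/
theorem evalBool_linearFamily (n : ℕ) (x : Fin n → Bool) :
    evalBool (∑ i : Fin n, MvPolynomial.C (1 / (n : ℝ)) * MvPolynomial.X i) x =
      (((Finset.univ.filter fun k => x k = true).card : ℕ) : ℝ) / n := by
  unfold evalBool
  rw [map_sum, weight_eq_sum, Finset.sum_div]
  refine Finset.sum_congr rfl fun i _ => ?_
  rw [map_mul, MvPolynomial.eval_C, MvPolynomial.eval_X]
  ring

/-- `p_n = |x|/n` is weight-symmetric. [folklore] -/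
theorem linearFamily_symmetric (n : ℕ) (x x' : Fin n → Bool)
    (h : (Finset.univ.filter fun k => x k = true).card = (Finset.univ.filter fun k => x' k = true).card) :
    evalBool (∑ i : Fin n, MvPolynomial.C (1 / (n : ℝ)) * MvPolynomial.X i) x =
      evalBool (∑ i : Fin n, MvPolynomial.C (1 / (n : ℝ)) * MvPolynomial.X i) x' := by
  rw [evalBool_linearFamily, evalBool_linearFamily, h]

/-- **`p_n = |x|/n ∈ K_1`**: on the cube `p_n = Σ_i (x_i/√n)²` and `1 − p_n = Σ_i ((1 − x_i)/√n)²` (`x_i² = x_i`).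
[cite: KaniewskiLeeDewolf2015, Def. 7] -/
theorem pseudoBounded_linearFamily {n : ℕ} (hn : 1 ≤ n) :
    PseudoBounded 1 (∑ i : Fin n, MvPolynomial.C (1 / (n : ℝ)) * MvPolynomial.X i) := by
  have hn0 : (n : ℝ) ≠ 0 := by exact_mod_cast (show n ≠ 0 by omega)
  have hsq : Real.sqrt (1 / (n : ℝ)) ^ 2 = 1 / (n : ℝ) := Real.sq_sqrt (by positivity)
  refine ⟨n, fun j => MvPolynomial.C (Real.sqrt (1 / (n : ℝ))) * MvPolynomial.X j,
    fun j => MvPolynomial.C (Real.sqrt (1 / (n : ℝ))) * (1 - MvPolynomial.X j), ?_, ?_⟩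
  · intro j
    constructor
    · calc (MvPolynomial.C (Real.sqrt (1 / (n : ℝ))) * MvPolynomial.X j : MvPolynomial (Fin n) ℝ).totalDegree
          ≤ (MvPolynomial.C (Real.sqrt (1 / (n : ℝ))) : MvPolynomial (Fin n) ℝ).totalDegree +
            (MvPolynomial.X j : MvPolynomial (Fin n) ℝ).totalDegree := MvPolynomial.totalDegree_mul _ _
        _ = 1 := by rw [MvPolynomial.totalDegree_C, MvPolynomial.totalDegree_X, zero_add]
        _ ≤ 1 := le_rfl
    · calc (MvPolynomial.C (Real.sqrt (1 / (n : ℝ))) * (1 - MvPolynomial.X j) : MvPolynomial (Fin n) ℝ).totalDegree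
          ≤ (MvPolynomial.C (Real.sqrt (1 / (n : ℝ))) : MvPolynomial (Fin n) ℝ).totalDegree +
            (1 - MvPolynomial.X j : MvPolynomial (Fin n) ℝ).totalDegree := MvPolynomial.totalDegree_mul _ _
        _ ≤ 0 + max (1 : MvPolynomial (Fin n) ℝ).totalDegree (MvPolynomial.X j : MvPolynomial (Fin n) ℝ).totalDegree := by
            rw [MvPolynomial.totalDegree_C]
            exact add_le_add le_rfl (MvPolynomial.totalDegree_sub _ _)
        _ = 1 := by rw [MvPolynomial.totalDegree_one, MvPolynomial.totalDegree_X]; simp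
        _ ≤ 1 := le_rfl
  · intro x
    have hp := evalBool_linearFamily n x
    unfold evalBool at hp
    rw [hp, weight_eq_sum]
    simp only [map_mul, MvPolynomial.eval_C, MvPolynomial.eval_X, map_sub, map_one]
    constructor
    · rw [Finset.sum_div]
      refine Finset.sum_congr rfl fun i _ => ?_
      rw [mul_pow, hsq]
      cases x i <;> simp
    · have hn : (1 : ℝ) - (∑ k : Fin n, if x k = true then (1 : ℝ) else 0) / n =
          ∑ k : Fin n, ((1 : ℝ) - (if x k = true then (1 : ℝ) else 0)) * (1 / n) := by
        rw [← Finset.sum_mul, Finset.sum_sub_distrib, Finset.sum_const, Finset.card_univ, Fintype.card_fin,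
          nsmul_eq_mul, mul_one]
        field_simp
      rw [hn]
      refine Finset.sum_congr rfl fun i _ => ?_
      rw [mul_pow, hsq]
      cases x i <;> simp

/-- `E p_n = 1/2` (`n ≥ 1`): for every coordinate `k`, the bit-flip involution `x ↦ x ⊕ e_k` gives
`Σ_x 1[x_k] = Σ_x (1 − 1[x_k])`, i.e. `E 1[x_k] = 1/2`. [folklore] -/
theorem boolAvg_linearFamily {n : ℕ} (hn : 1 ≤ n) :
    boolAvg (evalBool (∑ i : Fin n, MvPolynomial.C (1 / (n : ℝ)) * MvPolynomial.X i)) = 1 / 2 := by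
  have hn0 : (n : ℝ) ≠ 0 := by exact_mod_cast (show n ≠ 0 by omega)
  have h2n : (2 : ℝ) ^ n ≠ 0 := by positivity
  -- `Σ_x 1[x_k] = 2^n / 2` for every coordinate `k`
  have hhalf : ∀ k : Fin n, ∑ x : Fin n → Bool, (if x k = true then (1 : ℝ) else 0) = (2 : ℝ) ^ n / 2 := by
    intro k
    have hflip := sum_flipBit k (fun x : Fin n → Bool => if x k = true then (1 : ℝ) else 0)
    have hpt : ∀ x : Fin n → Bool, (if (flipBit k x) k = true then (1 : ℝ) else 0) =
        1 - (if x k = true then (1 : ℝ) else 0) := by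
      intro x
      simp only [flipBit, Function.update_self]
      cases x k <;> simp
    simp_rw [hpt] at hflip
    rw [Finset.sum_sub_distrib, Finset.sum_const, Finset.card_univ, Fintype.card_fun, Fintype.card_bool,
      Fintype.card_fin, nsmul_eq_mul, mul_one] at hflip
    push_cast at hflip
    linarith
  unfold boolAvg
  have hfun : ∀ x : Fin n → Bool, evalBool (∑ i : Fin n, MvPolynomial.C (1 / (n : ℝ)) * MvPolynomial.X i) x =
      (∑ k : Fin n, (if x k = true then (1 : ℝ) else 0)) / n := by
    intro x; rw [evalBool_linearFamily, weight_eq_sum]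
  simp_rw [hfun]
  rw [← Finset.sum_div, Finset.sum_comm]
  simp_rw [hhalf]
  rw [Finset.sum_const, Finset.card_univ, Fintype.card_fin, nsmul_eq_mul]
  field_simp

/-- **`Var[p_n] = 1/(4n)`** (`E p_n = 1/2`, `E(|x| − n/2)² = n/4`). [cite: ODonnell2014, §2.3] -/
theorem boolVariance_linearFamily {n : ℕ} (hn : 1 ≤ n) :
    boolVariance (∑ i : Fin n, MvPolynomial.C (1 / (n : ℝ)) * MvPolynomial.X i) = 1 / (4 * n) := by
  have hn0 : (n : ℝ) ≠ 0 := by exact_mod_cast (show n ≠ 0 by omega)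
  unfold boolVariance
  rw [boolAvg_linearFamily hn]
  have hpt : ∀ x : Fin n → Bool,
      (evalBool (∑ i : Fin n, MvPolynomial.C (1 / (n : ℝ)) * MvPolynomial.X i) x - 1 / 2) ^ 2 =
        1 / (n : ℝ) ^ 2 * ((((Finset.univ.filter fun k => x k = true).card : ℕ) : ℝ) - n / 2) ^ 2 := by
    intro x
    rw [evalBool_linearFamily]
    field_simp
  have h := boolAvg_weight_sub_half_sq (N := n)
  unfold boolAvg at h ⊢
  simp_rw [hpt]
  rw [← Finset.mul_sum, mul_div_assoc, h]
  field_simp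

/-- **Every influence of `p_n` is `1/n²`** (a bit flip moves `|x|/n` by exactly `1/n`). [cite: ODonnell2014, §2.2] -/
theorem influence_linearFamily {n : ℕ} (i : Fin n) :
    influence i (∑ i : Fin n, MvPolynomial.C (1 / (n : ℝ)) * MvPolynomial.X i) = 1 / (n : ℝ) ^ 2 := by
  have hdiff : ∀ x : Fin n → Bool,
      (evalBool (∑ i : Fin n, MvPolynomial.C (1 / (n : ℝ)) * MvPolynomial.X i) x -
        evalBool (∑ i : Fin n, MvPolynomial.C (1 / (n : ℝ)) * MvPolynomial.X i) (flipBit i x)) ^ 2 =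
        1 / (n : ℝ) ^ 2 := by
    intro x
    rw [evalBool_linearFamily, evalBool_linearFamily, weight_eq_sum, weight_eq_sum, ← sub_div, ← Finset.sum_sub_distrib,
      Finset.sum_eq_single i]
    · simp only [flipBit, Function.update_self]
      cases x i <;> simp [div_pow]
    · intro k _ hk
      simp [flipBit, Function.update_of_ne hk]
    · intro h; exact absurd (Finset.mem_univ i) h
  unfold influence boolAvg
  simp_rw [hdiff]
  rw [Finset.sum_const, Finset.card_univ, Fintype.card_fun, Fintype.card_bool, Fintype.card_fin, nsmul_eq_mul]
  have h2n : (2 : ℝ) ^ n ≠ 0 := by positivity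
  push_cast
  field_simp

/-! ### §2 The Chebyshev calibrator is weight-symmetric -/

/-- The tree's Chebyshev calibrating instance `T_k(ȳ)²`, `ȳ = (1/n) Σ_i (1 − 2x_i) = 1 − 2|x|/n`, is weight-symmetric.
[cite: BealsEtAl2001, §4] -/
theorem chebyshev_symmetric (N k : ℕ) (x x' : Fin N → Bool)
    (h : (Finset.univ.filter fun j => x j = true).card = (Finset.univ.filter fun j => x' j = true).card) :
    evalBool ((Polynomial.aeval (∑ i : Fin N, (MvPolynomial.C (1 / (N : ℝ)) -
        MvPolynomial.C (2 / (N : ℝ)) * MvPolynomial.X i)) (Polynomial.Chebyshev.T ℝ (k : ℤ))) ^ 2) x =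
      evalBool ((Polynomial.aeval (∑ i : Fin N, (MvPolynomial.C (1 / (N : ℝ)) -
        MvPolynomial.C (2 / (N : ℝ)) * MvPolynomial.X i)) (Polynomial.Chebyshev.T ℝ (k : ℤ))) ^ 2) x' := by
  have hw : ∀ y : Fin N → Bool, ∑ i : Fin N, (1 - 2 * (if y i then (1 : ℝ) else 0)) =
      N - 2 * (((Finset.univ.filter fun j => y j = true).card : ℕ) : ℝ) := by
    intro y
    rw [Finset.sum_sub_distrib, Finset.sum_const, Finset.card_univ, Fintype.card_fin, nsmul_eq_mul, mul_one,
      ← Finset.mul_sum, weight_eq_sum]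
  rw [evalBool_chebyshevT_sq, evalBool_chebyshevT_sq, hw, hw, h]

/-! ### §3 The admissible exponents on the symmetric sub-cone -/

/-- **The symmetric sub-cone of `K` is settled.**  For real exponents `a, b`: a law
"`∃ C > 0`, every weight-symmetric pseudo-bounded `p` of order `T ≥ 1` with `Var[p] > 0` has a variable with
`C·Var[p]^a/T^b ≤ Inf_i[p]`" holds **iff `2 ≤ a ∧ 2 ≤ b`**.  (`←`: the sharp symmetric corner
`(1/256)(Var/T)² ≤ maxInf`, `Var ≤ 1`, `T ≥ 1`.  `→`, `a`: the degree-one family `|x|/n ∈ K_1` has `Var = 1/(4n)` and all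
influences `1/n² = 16 Var²`; `→`, `b`: the Chebyshev calibrator of order `12r` has `Var ≥ 1/2592` and all influences
`≤ 29/(12r)²`.)  [cite: AaronsonAmbainis2014, Conj. 6] [cite: KaniewskiLeeDewolf2015, Def. 7] [cite: BealsEtAl2001, §4] -/
theorem symmetricCorner_law_iff (a b : ℝ) :
    (∃ C : ℝ, 0 < C ∧ ∀ (N T : ℕ) (p : MvPolynomial (Fin N) ℝ),
        (∀ x x' : Fin N → Bool,
          (Finset.univ.filter fun k => x k = true).card = (Finset.univ.filter fun k => x' k = true).card →
            evalBool p x = evalBool p x') →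
        1 ≤ T → PseudoBounded T p → 0 < boolVariance p →
          ∃ i : Fin N, C * boolVariance p ^ a / (T : ℝ) ^ b ≤ influence i p) ↔
      (2 ≤ a ∧ 2 ≤ b) := by
  constructor
  · rintro ⟨C, hC, h⟩
    -- `a ≥ 2`: the degree-one family at `T = 1`
    have ha2 : 2 ≤ a := by
      by_contra hlt
      push Not at hlt
      have he : 0 < 2 - a := by linarith
      set L : ℝ := C / 16 with hL
      have hL0 : 0 < L := by positivity
      set M : ℝ := L ^ (1 / (2 - a)) with hM
      have hM0 : 0 < M := Real.rpow_pos_of_pos hL0 _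
      obtain ⟨n₀, hn₀⟩ := exists_nat_gt (1 / (4 * M))
      set n := n₀ + 1 with hndef
      have hn : 1 ≤ n := by omega
      have hnR : (1 / (4 * M) : ℝ) < n := by
        have : (n₀ : ℝ) < n := by rw [hndef]; push_cast; linarith
        linarith
      have hn0 : (0 : ℝ) < n := by exact_mod_cast (show 0 < n by omega)
      set x : ℝ := 1 / (4 * (n : ℝ)) with hx
      have hx0 : 0 < x := by positivity
      have hxM : x < M := by
        rw [hx, div_lt_iff₀ (by positivity)]
        rw [div_lt_iff₀ (by positivity)] at hnR
        linarith
      have hVpos : 0 < boolVariance (∑ i : Fin n, MvPolynomial.C (1 / (n : ℝ)) * MvPolynomial.X i) := by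
        rw [boolVariance_linearFamily hn]; exact hx0
      obtain ⟨i, hi⟩ := h n 1 _ (linearFamily_symmetric n) le_rfl (pseudoBounded_linearFamily hn) hVpos
      rw [boolVariance_linearFamily hn, influence_linearFamily, Nat.cast_one, Real.one_rpow, div_one] at hi
      -- `hi : C x^a ≤ 1/n² = 16 x²`
      have h16 : 1 / (n : ℝ) ^ 2 = 16 * x ^ 2 := by rw [hx]; field_simp; ring
      rw [h16] at hi
      have hxsplit : x ^ 2 = x ^ a * x ^ (2 - a) := by
        rw [← Real.rpow_add hx0, show a + (2 - a) = (2 : ℝ) by ring]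
        exact_mod_cast (Real.rpow_natCast x 2).symm
      have hxa : 0 < x ^ a := Real.rpow_pos_of_pos hx0 a
      have hle : L ≤ x ^ (2 - a) := by
        rw [hL, div_le_iff₀ (by norm_num : (0 : ℝ) < 16)]
        rw [hxsplit] at hi
        by_contra hcon
        push Not at hcon
        have : 16 * (x ^ a * x ^ (2 - a)) < x ^ a * C := by
          have := mul_lt_mul_of_pos_left hcon hxa
          nlinarith [this]
        nlinarith
      have hlt2 : x ^ (2 - a) < M ^ (2 - a) := Real.rpow_lt_rpow hx0.le hxM he
      have hMe : M ^ (2 - a) = L := by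
        rw [hM, ← Real.rpow_mul hL0.le, one_div_mul_cancel he.ne', Real.rpow_one]
      linarith [hMe ▸ hlt2]
    refine ⟨ha2, ?_⟩
    -- `b ≥ 2`: the Chebyshev calibrator (weight-symmetric)
    have ha : 0 ≤ a := by linarith
    by_contra hlt
    push Not at hlt
    set v : ℝ := 1 / 2592 with hv
    have hv0 : 0 < v := by norm_num
    set K : ℝ := C * v ^ a with hK
    have hK0 : 0 < K := mul_pos hC (Real.rpow_pos_of_pos hv0 a)
    have he : 0 < 2 - b := by linarith
    set M : ℝ := (29 / K) ^ (1 / (2 - b)) with hM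
    have hM0 : 0 ≤ M := Real.rpow_nonneg (by positivity) _
    obtain ⟨r₀, hr₀⟩ := exists_nat_gt M
    set r := r₀ + 1 with hrdef
    have hr : 1 ≤ r := by omega
    obtain ⟨hpb, hvarP, hinfP⟩ := chebyshev_calibration r hr
    have hk1 : 1 ≤ 4 * (3 * r) := by omega
    obtain ⟨i, hi⟩ := h (144 * r ^ 2) (4 * (3 * r)) _ (chebyshev_symmetric (144 * r ^ 2) (4 * (3 * r))) hk1 hpb
      (lt_of_lt_of_le hv0 hvarP)
    have hinf := hinfP i
    set V := boolVariance ((Polynomial.aeval (∑ i : Fin (144 * r ^ 2),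
          (MvPolynomial.C (1 / ((144 * r ^ 2 : ℕ) : ℝ)) -
            MvPolynomial.C (2 / ((144 * r ^ 2 : ℕ) : ℝ)) * MvPolynomial.X i))
          (Polynomial.Chebyshev.T ℝ ((4 * (3 * r) : ℕ) : ℤ))) ^ 2) with hV
    set k : ℝ := ((4 * (3 * r) : ℕ) : ℝ) with hkdef
    have hkr : k = 12 * r := by rw [hkdef]; push_cast; ring
    have hr0 : (0 : ℝ) < r := by exact_mod_cast (show 0 < r by omega)
    have hkpos : 0 < k := by rw [hkr]; positivity
    have hkM : M < k := by
      have : (r₀ : ℝ) + 1 = r := by rw [hrdef]; push_cast; ring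
      rw [hkr]; nlinarith
    have hkb : 0 < k ^ b := Real.rpow_pos_of_pos hkpos b
    have hVa : v ^ a ≤ V ^ a := Real.rpow_le_rpow hv0.le hvarP ha
    have h1 : K / k ^ b ≤ 29 / k ^ 2 := by
      calc K / k ^ b ≤ C * V ^ a / k ^ b :=
            div_le_div_of_nonneg_right (mul_le_mul_of_nonneg_left hVa hC.le) hkb.le
        _ ≤ _ := hi
        _ ≤ 29 / k ^ 2 := hinf
    have hsplit : k ^ 2 = k ^ b * k ^ (2 - b) := by
      rw [← Real.rpow_add hkpos, show b + (2 - b) = (2 : ℝ) by ring]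
      exact_mod_cast (Real.rpow_natCast k 2).symm
    have h2 : K * k ^ (2 - b) ≤ 29 := by
      rw [div_le_div_iff₀ hkb (by positivity), hsplit] at h1
      nlinarith [h1, Real.rpow_pos_of_pos hkpos (2 - b)]
    have h3 : M ^ (2 - b) < k ^ (2 - b) := Real.rpow_lt_rpow hM0 hkM he
    have hMe : M ^ (2 - b) = 29 / K := by
      rw [hM, ← Real.rpow_mul (by positivity), one_div_mul_cancel he.ne', Real.rpow_one]
    rw [hMe] at h3
    have h4 : 29 < K * k ^ (2 - b) := by
      have := mul_lt_mul_of_pos_left h3 hK0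
      rwa [mul_div_cancel₀ _ hK0.ne'] at this
    linarith
  · rintro ⟨ha, hb⟩
    refine ⟨1 / 256, by norm_num, ?_⟩
    intro N T p hsym hT hpb hv
    obtain ⟨i, hi⟩ := pseudoBoundedAA_symmetricCorner_sharp N T p (boolVariance p) hsym hpb hv le_rfl
    refine ⟨i, le_trans ?_ hi⟩
    have hV1 : boolVariance p ≤ 1 := (boolVariance_le_quarter hpb.bounded).trans (by norm_num)
    have hT1 : (1 : ℝ) ≤ (T : ℝ) := by exact_mod_cast hT
    have hVa : boolVariance p ^ a ≤ boolVariance p ^ 2 := by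
      rw [← Real.rpow_two]
      exact Real.rpow_le_rpow_of_exponent_ge hv hV1 ha
    have hTb : (T : ℝ) ^ 2 ≤ (T : ℝ) ^ b := by
      rw [← Real.rpow_two]
      exact Real.rpow_le_rpow_of_exponent_le hT1 hb
    have hTb0 : (0 : ℝ) < (T : ℝ) ^ 2 := by positivity
    rw [div_pow, mul_div_assoc]
    refine mul_le_mul_of_nonneg_left ?_ (by norm_num)
    calc boolVariance p ^ a / (T : ℝ) ^ b ≤ boolVariance p ^ 2 / (T : ℝ) ^ b :=
          div_le_div_of_nonneg_right hVa (le_trans hTb0.le hTb)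
      _ ≤ boolVariance p ^ 2 / (T : ℝ) ^ 2 := div_le_div_of_nonneg_left (sq_nonneg _) hTb0 hTb

end Summit.QuantumAdvantage.QuantumAdvantage.Theorems.SosSandwich.SymmetricCorner

end
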